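/-
Width seat `ym-line-cbag-p1-w3` (prover-ym-line-cbag-p1-w3-g2-0), route `ColdBoxAllGroups`, crux `BulkAllGroups`
(stmt-QuantumFields-22255), line `dlr-chessboard-G` (lead `ym-line-cbag-p2`, skeleton v5): the datum package in the lead's `datVec` vocabulary.
-/
import Summits.QuantumFields.YangMills.Theorems.ColdBoxAllGroupsBulkAllGroupsDatumPackageG
import Summits.QuantumFields.YangMills.Theorems.ColdBoxAllGroupsOneScaleDatumDefsG

/-!
# Crux `BulkAllGroups` (stmt-QuantumFields-22255): the datum package phrased with `datVec` (`Theorems/ColdBoxAllGroupsOneScaleDatumDefsG.lean`)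

`exists_datum_packageG_datVec` — the datum package `exists_datum_chartCoords_energy_eventuallyG` (`…BulkAllGroupsDatumPackageG`) with its
clause (1) in the form the lead asked for (item evidence `COORD-p2-datumdefs.md`, 2026-08-28): a COLOUR-MAJOR datum
`ϑ : Fin D → (ZdEdge 4 → ℝ)` with `W e = expChart ρ (datVec ϑ e)` for EVERY edge `e` (`W` the forest-gauged truncated gauge copy of the
crude-good `ω`, `datVec ϑ e = (ϑ c e)_c ∈ ℝ^D`), `‖datVec ϑ e‖ ≤ Ca·β^{3θ+δ−1/2}` and `Σ_c (ϑ c e)² ≤ Ca²·β^{6θ+2δ−1}`, `datVec ϑ e = 0` wherever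
`W e = 1` (so on the temporal forest and off the enlarged box), the competitor `s c = ϑ c|_free`, and the energy clause
`Σ_c M_{ϑ_c}(s_c) ≤ CE·(2H+3)⁴·β^{2δ−1}` of `KernelMeanExpansionG` / `KernelCovExpansionG`; `datVec_smul_family` — `datVec (κ•ϑ) = κ•datVec ϑ`
(for the `1/√2` reconciliation of `…BulkAllGroupsUnitsShiftG`).  No new definition; standard axioms.  NOT a claim about the mass gap; the
Yang–Mills mass gap is NOT proved by any of this (rung-level support of R2xi-G `XiPow`, RECORD label).
-/

set_option autoImplicit false

noncomputable section

open Finset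
open Literature.Probability.LatticeModels Literature.MathematicalPhysics Literature.MathematicalPhysics.QuantumLattice
open Literature.MathematicalPhysics.QuantumFieldTheory Literature.MathematicalPhysics.QuantumFieldTheory.AxialGauge
open Literature.MathematicalPhysics.QuantumFieldTheory.LatticeMaxwell
open Summit.QuantumFields.YangMills.Theorems.WeakCouplingRates
open Summit.QuantumFields.YangMills.Theorems.FreeEnergyLogCoefficient

namespace Summit.QuantumFields.YangMills.Theorems.ColdBoxAllGroups

/-- `datVec` is linear in the colour-major datum: `datVec (c ↦ κ•ϑ c) e = κ • datVec ϑ e`. -/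
theorem datVec_smul_family {D : ℕ} (κ : ℝ) (ϑ : Fin D → (Literature.MathematicalPhysics.QuantumLattice.ZdEdge 4 → ℝ))
    (e : Literature.MathematicalPhysics.QuantumLattice.ZdEdge 4) : datVec (fun c => κ • ϑ c) e = κ • datVec ϑ e := by
  ext c; simp [datVec]

variable {N : ℕ} [NeZero N] {G : Type*} [Group G] [TopologicalSpace G] [CompactSpace G] [MeasurableSpace G]
variable (ρ : G →* Matrix (Fin N) (Fin N) ℂ)

/-- **The datum package with `datVec`**, every compact `G` presented in `U(N)` (`ρ` faithful continuous unitary, `N ≥ 1`; `0 < θ`, `0 ≤ δ`,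
`9θ + δ < 1/2`): constants `Ca, CE > 0` and `β₀` such that for `β ≥ β₀`, `H = ⌈β^θ⌉`, every crude-good `ω` admits a gauge `g`, a colour-major datum
`ϑ` and competitors `s c = ϑ c|_free` with (1) `W e = expChart ρ (datVec ϑ e)` for every edge; (2) `‖datVec ϑ e‖ ≤ Ca·β^{3θ+δ−1/2}` and
(2') `Σ_c (ϑ c e)² ≤ Ca²·β^{6θ+2δ−1}` for every edge; (3) `datVec ϑ e = 0` wherever `W e = 1`; (3') `ϑ c (x, e₀) = 0` on the temporal forest;
(4) `s c e' = ϑ c e'`; (5) `Σ_c M_{ϑ_c}(s_c) ≤ CE(2H+3)⁴β^{2δ−1}`. -/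
theorem exists_datum_packageG_datVec (hρ : Continuous ρ) (hinj : Function.Injective ρ)
    (hρu : ∀ g, ρ g ∈ Matrix.unitaryGroup (Fin N) ℂ) {θ δ : ℝ} (hθ : 0 < θ) (hδ : 0 ≤ δ) (hwin : 9 * θ + δ < 1 / 2) :
    ∃ Ca CE : ℝ, 0 < Ca ∧ 0 < CE ∧ ∃ β₀ : ℝ, ∀ β : ℝ, β₀ ≤ β → ∀ ω : LGConfig 4 G, CrudeGoodG ρ β δ ⌈β ^ θ⌉₊ ω →
      ∃ (g : Site 4 → G) (ϑ : Fin (dimE ρ) → Literature.MathematicalPhysics.QuantumLattice.ZdEdge 4 → ℝ)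
        (s : Fin (dimE ρ) → DirFree ⌈β ^ θ⌉₊ → ℝ),
        (∀ e, forestFix ⌈β ^ θ⌉₊ (glueWith (boxEdgesAt dirCorner (2 * ⌈β ^ θ⌉₊ + 3))
            (fun e' : ↥(boxEdgesAt dirCorner (2 * ⌈β ^ θ⌉₊ + 3)) => gaugeTransformZd g ω e'.1) (fun _ => 1)) e =
            expChart ρ (datVec ϑ e)) ∧
        (∀ e, ‖datVec ϑ e‖ ≤ Ca * β ^ (3 * θ + δ - 1 / 2)) ∧
        (∀ e, ∑ c, ϑ c e ^ 2 ≤ Ca ^ 2 * β ^ (6 * θ + 2 * δ - 1)) ∧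
        (∀ e, forestFix ⌈β ^ θ⌉₊ (glueWith (boxEdgesAt dirCorner (2 * ⌈β ^ θ⌉₊ + 3))
            (fun e' : ↥(boxEdgesAt dirCorner (2 * ⌈β ^ θ⌉₊ + 3)) => gaugeTransformZd g ω e'.1) (fun _ => 1)) e = 1 → datVec ϑ e = 0) ∧
        (∀ x : Site 4, (∀ k : Fin 4, 1 ≤ x k ∧ x k + 1 ≤ 2 * (⌈β ^ θ⌉₊ : ℤ)) → ∀ c, ϑ c (x, 0) = 0) ∧
        (∀ c (e' : DirFree ⌈β ^ θ⌉₊), s c e' = ϑ c e'.1.1) ∧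
        ∑ c : Fin (dimE ρ), formM (fun e => e ∉ dirFreeEdges ⌈β ^ θ⌉₊) dirCorner (2 * ⌈β ^ θ⌉₊ + 3) (ϑ c) (s c) ≤
          CE * (2 * (⌈β ^ θ⌉₊ : ℝ) + 3) ^ 4 * β ^ (2 * δ - 1) := by
  obtain ⟨Ca, CE, hCa, hCE, β₀, h⟩ := exists_datum_chartCoords_energy_eventuallyG ρ hρ hinj hρu hθ hδ hwin
  refine ⟨Ca, CE, hCa, hCE, max β₀ 1, fun β hβ ω hω => ?_⟩
  have hβ1 : (1 : ℝ) ≤ β := (le_max_right _ _).trans hβ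
  have hβ0 : 0 < β := by linarith
  obtain ⟨g, a, hW, han, ha0, hforest, hE⟩ := h β ((le_max_left _ _).trans hβ) ω hω
  have hdv : ∀ e, datVec (fun c e => a e c) e = a e := fun e => by ext c; rfl
  refine ⟨g, fun c e => a e c, fun c e' => a e'.1.1 c, fun e => by rw [hdv, hW e], fun e => by rw [hdv]; exact han e, fun e => ?_,
    fun e he => by rw [hdv]; exact ha0 e he, fun x hx c => ?_, fun c e' => rfl, hE⟩
  · rw [← norm_sq_eq_sum_sq]
    have h2 := pow_le_pow_left₀ (norm_nonneg _) (han e) 2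
    have e2 : (Ca * β ^ (3 * θ + δ - 1 / 2)) ^ 2 = Ca ^ 2 * β ^ (6 * θ + 2 * δ - 1) := by
      rw [mul_pow, show (6 : ℝ) * θ + 2 * δ - 1 = (3 * θ + δ - 1 / 2) * ((2 : ℕ) : ℝ) by push_cast; ring, Real.rpow_mul_natCast hβ0.le]
    rwa [e2] at h2
  · show a (x, 0) c = 0
    rw [hforest x hx]; rfl

end Summit.QuantumFields.YangMills.Theorems.ColdBoxAllGroups

end
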